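import Summits.QuantumFields.BalabanUV.Beta.FP.EvenKernelNoGo

/-!
# `BalabanUV.Beta.FP.ReflectionFlipNoGo` — road «FP» for binder row D1, `RESIDUAL-FP` ROW #22, RULING R-FP-42 (4d): THE NO-GO FOR THE PARITY-TWIN BRIDGE —
# A KERNEL REFLECTION-COVARIANT IN BOTH READINGS (`AxisReflectionCovariant K` AND `AxisReflectionCovariant (flipK K)`) HAS `2e_μ`-PERIODIC, HENCE VANISHING,
# OFF-DIAGONAL CHANNELS; WITH `hgerm` THE SLOPE IS ZERO

HONEST DEPENDENCY (page 1, mandatory): continuum YM on T⁴ ⇐ BetaPertH ∧ nine spine estimates (0/9 proved); BetaPertH ⇐ (D1) ∧ (D4) ∧ CAP+tail;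
G-an2-4 gates asym, D1 and NE2/3/4.  HONEST FRAMING (cell contract, verbatim): «discharging `BetaPertH` makes Bałaban's UV stability UNCONDITIONAL —
a real constructive-QFT result; it is NOT the continuum limit and NOT the Clay problem.»  THIS MODULE is a [folklore] kernel no-go about ABSTRACT kernels on `ℤ⁴` in the
γ-END's binder shapes (beta-d1-formalise-leaf-01-g10's `FP/EvenKernelNoGo` with the evenness letter replaced by the SECOND reflection reading); it asserts nothing about
Bałaban's objects or about `PiBF`; no `def`, no `def … : Prop`, nothing cited, 0 sorry; 0∕4 row-D1 binders; NOT (Kcov), NOT (ASYMP), NOT D1, NOT BetaPertH, NOT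
continuum, NOT Clay.

ABSOLUTE RULE (cell charter, verbatim): «No internally-minted statement may enter as a cited fact. Every hypothesis is either kernel-proved in this
package or a verbatim quotation of a PUBLISHED theorem with page reference. The manuscript(s) under audit are NOT citable for their own disputed
steps — they are the thing under adjudication; programme-internal (2001/route/tribunal) claims are never citable.»

WHY (owner gen 11, journal l.30335 (4d)).  Row #22's first repair idea (l.30153 (2)(b)) was a TRANSPOSE∕PARITY bridge carrying the END's gluon data from the straight leg
`Pkerˢˢ` to `Pker` as typed.  The site parity `π` does map `Pkerˢˢ ↦ Pker`, but it turns the `flipK` reading of `PolarizationSign.AxisReflectionCovariant` around: parity-twin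
data at `Pker` give a `PiBF` that is `flipK` of the straight BF polarization, whose FLIPPED kernel is covariant by the cell's reflection theorems — so the END's letter
`hKcov : AxisReflectionCovariant (flipK (PiBF …))` at parity-twin data would be covariance of the UNFLIPPED straight kernel ON TOP of the flipped one.  This file shows that
the two readings together are degenerate: at the axis of the left index the two laws read `K μ ν (ε_μ w − e_μ) = −K μ ν w = K μ ν (ε_μ w + e_μ)`, i.e. the off-diagonal
channel is `2e_μ`-periodic, hence zero under the γ-END's decay (K6), hence the `hgerm` slope vanishes (`EvenKernelNoGo` §2–§3 BY NAME).  The bridge of record is the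
parity-free LEG RELABELLING of `FP/LegShiftDictionary` (R-FP-42), for which exactly one reading holds.

CONTENT: `periodic_of_cov_of_cov_flip`, `periodic_two_nsmul_of_cov_of_cov_flip`, **`offDiag_eq_zero_of_cov_of_cov_flip`**, **`hasym_hypotheses_degenerate_cov_of_cov_flip`**.
Provenance: road FP OWNER b2b-balaban-beta-d1-p3 gen 11 (prover-b2b-balaban-beta-d1-p3-g11-0), 2026-08-21, `RESIDUAL-FP.md` §12 row #22, ruling R-FP-42 (4d).
-/

noncomputable section

namespace Summit.QuantumFields.BalabanUV.Beta.FP.ReflectionFlipNoGo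

open Finset
open Literature.Probability.LatticeModels (annulus)
open Literature.MathematicalPhysics.QuantumFieldTheory.Balaban1983to89
open Literature.MathematicalPhysics.QuantumFieldTheory.Balaban1983to89.Beta
open Literature.MathematicalPhysics.QuantumFieldTheory.Balaban1983to89.B6BondElimination (unitVec unitVec_apply)
open PolarizationSign (AxisReflectionCovariant axisReflect axisReflect_apply axisReflect_axisReflect reflSign)
open OneStepKernelFamily (flipK flipK_apply)
open DressedMomentNormalisation (EKer)
open DyadicShell (Pt supNorm)
open Summit.QuantumFields.BalabanUV.Beta.FP.EvenKernelNoGo (neg_of_refl_left axisReflect_neg eq_zero_of_periodic_of_decay slope_eq_zero_of_hgerm_of_zero)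

/-! ## §1 Both readings ⟹ a `2e_μ`-periodic off-diagonal channel (any dimension) -/

section General

variable {d : ℕ}

/-- [folklore] **BOTH READINGS ⟹ PERIODICITY.**  If `K` AND `flipK K` are axis-reflection covariant in the printed sense (5.7), then every off-diagonal channel
`μ ≠ ν` satisfies `K μ ν (w + e_μ) = K μ ν (w − e_μ)`: the law for `K` at `ε_μ w` gives `K μ ν (w − e_μ) = −K μ ν (ε_μ w)`, the law for `flipK K` at `ε_μ(−w)` gives
`K μ ν (w + e_μ) = −K μ ν (ε_μ w)`. -/
theorem periodic_of_cov_of_cov_flip {K : EKer d} (hR : AxisReflectionCovariant K) (hRf : AxisReflectionCovariant (flipK K)) {μ ν : Fin d}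
    (hμν : μ ≠ ν) (w : Fin d → ℤ) : K μ ν (w + unitVec μ) = K μ ν (w - unitVec μ) := by
  have h1 := neg_of_refl_left hR hμν (axisReflect μ w)
  have h2 := neg_of_refl_left hRf hμν (axisReflect μ (-w))
  rw [axisReflect_axisReflect] at h1 h2
  rw [flipK_apply, flipK_apply, axisReflect_neg, neg_neg, neg_sub, sub_neg_eq_add, add_comm] at h2
  rw [h2, h1]

/-- [folklore] Hence `K μ ν (w + (2n)•e_μ) = K μ ν w` for every `n : ℕ`. -/
theorem periodic_two_nsmul_of_cov_of_cov_flip {K : EKer d} (hR : AxisReflectionCovariant K) (hRf : AxisReflectionCovariant (flipK K)) {μ ν : Fin d}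
    (hμν : μ ≠ ν) (w : Fin d → ℤ) (n : ℕ) : K μ ν (w + ((2 * n : ℕ) : ℤ) • unitVec μ) = K μ ν w := by
  induction n with
  | zero => simp
  | succ n ih =>
    have h := periodic_of_cov_of_cov_flip hR hRf hμν (w + ((2 * n : ℕ) : ℤ) • unitVec μ + unitVec μ)
    rw [add_sub_cancel_right, ih] at h
    have e1 : ((2 * (n + 1) : ℕ) : ℤ) • unitVec μ = ((2 * n : ℕ) : ℤ) • unitVec μ + unitVec μ + unitVec μ := by
      have e0 : ((2 * (n + 1) : ℕ) : ℤ) = ((2 * n : ℕ) : ℤ) + 1 + 1 := by push_cast; ring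
      rw [e0, add_smul, add_smul, one_smul]
    rw [e1, ← add_assoc, ← add_assoc]
    exact h

end General

/-! ## §2 `d = 4`: with the γ-END's decay the channel vanishes; with `hgerm` the slope vanishes -/

section Four

/-- **NO-GO (both readings).**  A kernel on `ℤ⁴` with the γ-END's sextic decay (K6) that is axis-reflection covariant in BOTH readings — `AxisReflectionCovariant K`
and `AxisReflectionCovariant (flipK K)` — has IDENTICALLY VANISHING OFF-DIAGONAL CHANNELS. [folklore] -/
theorem offDiag_eq_zero_of_cov_of_cov_flip {K : EKer 4} {C : ℝ} (hK : ∀ c e (t : Pt), |K c e t| ≤ C / ((supNorm t : ℝ) + 1) ^ 6)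
    (hcov : AxisReflectionCovariant K) (hcovf : AxisReflectionCovariant (flipK K)) {μ ν : Fin 4} (hμν : μ ≠ ν) (t : Pt) :
    K μ ν t = 0 :=
  eq_zero_of_periodic_of_decay (f := K μ ν) μ (fun w n => periodic_two_nsmul_of_cov_of_cov_flip hcov hcovf hμν w n) (hK μ ν) t

/-- **THE NO-GO IN THE γ-END's EXACT BINDER SHAPES.**  (K6) + `hgerm` at an off-diagonal channel + BOTH reflection readings ⟹ the slope `s = 0` and the channel
vanishes: an END whose `hKcov` asks the `flipK` reading can NOT be fed data whose UNFLIPPED polarization is the covariant one (the parity twins of straight data),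
except in the degenerate case. [folklore] -/
theorem hasym_hypotheses_degenerate_cov_of_cov_flip {K : EKer 4} {C : ℝ}
    (hK : ∀ c' e (t : Pt), |K c' e t| ≤ C / ((supNorm t : ℝ) + 1) ^ 6)
    (hcov : AxisReflectionCovariant K) (hcovf : AxisReflectionCovariant (flipK K))
    {μ ν : Fin 4} (hμν : μ ≠ ν) {s c₀ Cg : ℝ}
    (hgerm : ∀ M : ℕ, 1 ≤ M → |∑ z ∈ annulus 4 0 M, K μ ν z * (z μ : ℝ) * (z ν : ℝ) - (s * Real.log M + c₀)| ≤ Cg) :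
    s = 0 ∧ ∀ t : Pt, K μ ν t = 0 :=
  have h0 : ∀ t : Pt, K μ ν t = 0 := offDiag_eq_zero_of_cov_of_cov_flip hK hcov hcovf hμν
  ⟨slope_eq_zero_of_hgerm_of_zero h0 hgerm, h0⟩

end Four

end Summit.QuantumFields.BalabanUV.Beta.FP.ReflectionFlipNoGo

end
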